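/-
Copyright: the b2b-balaban T⁴-continuum CRUX team, row NE7b leaf lineage `t4-ne7b-formalise-leaf-02` (gen 135). Project licence.
-/
import Summits.QuantumFields.BalabanUV.T4Continuum.Spine.NE7b.SineTentFloorTwoFamilies
import Summits.QuantumFields.BalabanUV.T4Continuum.Spine.NE7b.CurlTermsLinear
import Summits.QuantumFields.BalabanUV.T4Continuum.Spine.NE7b.PlaquetteTermDisplacement
import Summits.QuantumFields.BalabanUV.T4Continuum.Spine.NE7b.AveragedCurlFormSplit
import Summits.QuantumFields.BalabanUV.T4Continuum.Spine.NE7b.AverageTermsLinear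

/-!
# THE FULL-FORM (h2) FLOOR AT k = 1 WITH EVERY BOOKKEEPING INPUT DISCHARGED: for `F(B) = Σ_P X_P(B)² + Σ_j Y_j(B)²` on the two-scale torus `(ℤ∕nM)^d` — the
# covariant curls of the plaquettes (CCTL's shape, transports `w` a parameter) AND the weighted rotated one-step averages at the coarse bonds (weight `ω`,
# transports `w′` parameters) — and the sine-tent quadratic partition of scale `L` (`nM = M′L`):
# `((c_loc − (1+t⁻¹)·(2^d·(π∕2L)²·4·2(d−1) + (n^{d+1}+1)2^d·(|ω|n)²·((d+1)(n−1)π∕2L)²·n^{d+1}·n))∕(1+t))·Σ_c‖B c‖² ≤ F(B)` on `good` — what stays displayed is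
# ONLY the local floor `c_loc` of the localised fields (row NE7b, node U5c; residual (R2′) family (2), letter (ℓ1); capstone junction — `…CurlOnlySineFloor`'s twin)

Cell `pub-balaban`, sub-cell `t4`, spine estimate NE7b (`T4WeightBudget.RelWeightBound`; the cell's OWN estimate — NOT PRINTED in [Bałaban 1983–89],
NOT PROVED).  Crux-route work under `Spine/NE7b/`; NOTHING of Bałaban's estimates is asserted; no `def`; zero `sorry`; no `T4Continuum/Support` leaf
(FREEZE (0)).  Imports BY NAME: this lineage's `…SineTentFloorTwoFamilies` (STF2: `ims_floor_of_sine_tent_partition_two_unit_disp`), `…CurlTermsLinear` (CTL: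
`norm_curlMap_le`, `sum_sq_norm_curlMaps_eq`), `…PlaquetteTermDisplacement` (PTD: `exists_unit_plaquetteBonds`), `…AveragedCurlFormSplit` (ACFS:
`card_image_four_le`), `…TorusPlaquetteIncidence` (TPI: `card_plaquettes_through_bond_le`), `…AverageTermsLinear` (ATL: `norm_avgMap_le`,
`sum_sq_norm_avgMaps_eq`) and `…TorusAverageIncidence` (TAI: `card_image_avgBonds_le`, `card_terms_through_bond_le`, `exists_displacement_avgBonds`).

WHY.  `HOME/b2b-balaban-r1/SectE-interface-proof.md` §5.5: the (h2) input of the `γ₀` assembly at `k = 1` is an IMS floor for the FULL form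
`F_V^{full}(B′) = n^{d−2}Σ_c|(Q₁(V)B′)(c)|² + Σ_P|(∂_V B′)(P)|²`, because the flat floor (B6 Lemma 2.4: `c‖Y‖² ≤ n^{d−2}|QY|² + |∂Y|²`) needs BOTH families.
`…CurlOnlySineFloor` (COSF) discharged every bookkeeping letter for the curl family alone; THIS FILE does it for both families at once, through leaf-05 g158's
two-family skeleton (AFS2) fed by the sine partition (STF2): the curl family's `(inc, R, ℓ = 1, a = 4, b = 2(d−1), hunit)` from CTL ∕ PTD ∕ ACFS ∕ TPI, the average
family's `(inc, R, ℓ = |ω|n, a = n^{d+1}, b = n, D = (d+1)(n−1))` from ATL ∕ TAI.  The weight `ω` (print: `n^{−(d+1)}`, `× n^{(d−2)∕2}` with the prefactor inside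
the square), the transports and WHICH typed operator is `Q₁(V)` remain the (A3) ∕ OWNER's (Q-leaf05-g157-1): parameters.

WHAT IS PROVED ([folklore]): **`ims_floor_full_form`** — on `(ℤ∕nM)^d` with `nM = M′·L` (`M′ ≥ 2` partition cubes of side `L` per axis, offset `c₀`), for the curl
terms (CTL's maps by position, transports `w_i ∈ U1`) with functional `X` of CCTL's shape, the average terms (ATL's maps, weight `ω`, transports `w′ ∈ U1`) with
functional `Y` of ATL's shape, and the sine-tent cutoffs `h_S`: if the localised fields obey the local floor
`c_loc·Σ_c‖h_S(c)B(c)‖² ≤ Σ_P‖T¹_P(h_S B)‖² + Σ_j‖T²_j(h_S B)‖²` on `good`, then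
`((c_loc − (1+t⁻¹)·(ε_curl + ε_avg))∕(1+t))·Σ_c‖B c‖² ≤ Σ_P X_P(B)² + Σ_j Y_j(B)²` for `good B`, with
`ε_curl = 2^d·1²·(π∕(2L))²·4·2(d−1)` and `ε_avg = (n^{d+1}+1)·2^d·(|ω|n)²·((d+1)(n−1)·π∕(2L))²·n^{d+1}·n` — every letter a number.
By value (d = 4, `ω = n^{−4}`): `ε_avg·L² = (n⁵+1)·16·n^{−6}·25(n−1)²·(π²∕4)·n⁶ = 100π²(n⁵+1)(n−1)²` — `n = 2`: `3300π² ≈ 3.3·10⁴` vs `ε_curl·L² = 96π² ≈ 947`: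
the crude average letters (`a = n^{d+1}`, `μ = (a+1)2^d`, `b = n`, `λ = Dλ₁`) dominate; the sharp ones (`b = 2`, distinct bonds `(2n−1)n^{d−1}`, box-`μ`) are later
files if the constant matters (TAI's docstring).

NOT HERE (honest): the local floor `c_loc` itself (Lemma 5.5: covariant B6 Lemma 2.4′ per cube in the chosen currency — the per-cube gauge letters CCTL (ℓ1) ∕
LGTS τ ∕ AFI ∕ AFC ∕ AFFC), `good`, the (A3) data `ω`, `w`, `w′`; anything of Bałaban's estimates.
BY-NAME EFFECT ON THE WALL: NONE.  NE7b NOT PRINTED ∕ NOT PROVED; spine PROVED 0∕9; rung (B)+1 on ONE finite T⁴ — NOT infinite volume, NOT the mass gap, NOT Clay.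
HONEST DEPENDENCY: continuum YM on T⁴ ⇐ BetaPertH ∧ nine spine estimates (0/9 proved); BetaPertH ⇐ (D1) ∧ (D4) ∧ CAP+tail; G-an2-4 gates asym, D1 and NE2/3/4.
-/

set_option autoImplicit false

noncomputable section

open Finset
open Literature.MathematicalPhysics.QuantumFieldTheory.Balaban1983to89.B14.TentUnityTorus (tentZ)
open Literature.MathematicalPhysics.QuantumFieldTheory.Balaban1983to89.B7Prop1Explicit (U1)
open Literature.MathematicalPhysics.QuantumFieldTheory.Balaban1983to89.B7Eq78Linearization (conjR conjR_add conjR_smul_real)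
open Summit.QuantumFields.BalabanUV.T4Continuum.NE7b.SineTentFloorTwoFamilies (ims_floor_of_sine_tent_partition_two_unit_disp)
open Summit.QuantumFields.BalabanUV.T4Continuum.NE7b.CurlTermsLinear (norm_curlMap_le sum_sq_norm_curlMaps_eq)
open Summit.QuantumFields.BalabanUV.T4Continuum.NE7b.PlaquetteTermDisplacement (exists_unit_plaquetteBonds)
open Summit.QuantumFields.BalabanUV.T4Continuum.NE7b.AveragedCurlFormSplit (card_image_four_le)
open Summit.QuantumFields.BalabanUV.T4Continuum.NE7b.TorusPlaquetteIncidence (card_plaquettes_through_bond_le)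
open Summit.QuantumFields.BalabanUV.T4Continuum.NE7b.AverageTermsLinear (norm_avgMap_le sum_sq_norm_avgMaps_eq)
open Summit.QuantumFields.BalabanUV.T4Continuum.NE7b.TorusAverageIncidence (card_image_avgBonds_le card_terms_through_bond_le
  exists_displacement_avgBonds)

namespace Summit.QuantumFields.BalabanUV.T4Continuum.NE7b.FullFormSineFloor

variable {d : ℕ}
variable {𝔸 : Type*} [NormedRing 𝔸] [NormedAlgebra ℂ 𝔸] [NormOneClass 𝔸]

/-- **THE FULL-FORM (h2) FLOOR AT k = 1, EVERY BOOKKEEPING INPUT DISCHARGED** (see the module docstring; STF2 `ims_floor_of_sine_tent_partition_two_unit_disp` with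
the curl family's data from CTL ∕ PTD ∕ ACFS ∕ TPI and the average family's from ATL ∕ TAI).  Displayed: the local floor `c_loc` on `good`. [folklore] -/
theorem ims_floor_full_form (n M L Mp : ℕ) [NeZero n] [NeZero M] [NeZero (n * M)] [Fact (1 < n * M)] [NeZero Mp]
    (hL : 0 < L) (hMp : 2 ≤ Mp) (hN : n * M = Mp * L) (c₀ : ℕ)
    -- the curl family (CTL ∕ TPI): plaquette-to-bonds map, transports, maps by position, the curl functional
    (ι : (Fin d → ZMod (n * M)) × {a : Fin d × Fin d // a.1 < a.2} → Fin 4 → (Fin d → ZMod (n * M)) × Fin d)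
    (hι : ∀ x a, ι (x, a) = ![(x, a.1.1), (x + Pi.single a.1.1 1, a.1.2), (x + Pi.single a.1.2 1, a.1.1), (x, a.1.2)])
    (w : (Fin d → ZMod (n * M)) × {a : Fin d × Fin d // a.1 < a.2} → Fin 3 → 𝔸ˣ) (hw : ∀ P i, w P i ∈ U1 𝔸)
    (R : (Fin d → ZMod (n * M)) × {a : Fin d × Fin d // a.1 < a.2} → (Fin d → ZMod (n * M)) × Fin d → 𝔸 →ₗ[ℝ] 𝔸)
    (hR : ∀ P c, R P c =
        if c = ι P 0 then LinearMap.id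
        else if c = ι P 1 then LinearMap.mk ⟨conjR (w P 0), conjR_add (w P 0)⟩ (conjR_smul_real (w P 0))
        else if c = ι P 2 then -LinearMap.mk ⟨conjR (w P 1), conjR_add (w P 1)⟩ (conjR_smul_real (w P 1))
        else if c = ι P 3 then -LinearMap.mk ⟨conjR (w P 2), conjR_add (w P 2)⟩ (conjR_smul_real (w P 2))
        else 0)
    (X : (Fin d → ZMod (n * M)) × {a : Fin d × Fin d // a.1 < a.2} → ((Fin d → ZMod (n * M)) → Fin d → 𝔸) → ℝ)
    (hX : ∀ (y : Fin d → ZMod (n * M)) (a : {a : Fin d × Fin d // a.1 < a.2}) (B : (Fin d → ZMod (n * M)) → Fin d → 𝔸), X (y, a) B =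
      ‖B y a.1.1 + conjR (w (y, a) 0) (B (y + Pi.single a.1.1 1) a.1.2) - conjR (w (y, a) 1) (B (y + Pi.single a.1.2 1) a.1.1)
        - conjR (w (y, a) 2) (B y a.1.2)‖)
    -- the average family (ATL ∕ TAI): bonds-of-a-term map, weight, transports, maps, the average functional
    (ιA : (Fin d → ZMod M) × Fin d → (Fin d → Fin n) × Fin n → (Fin d → ZMod (n * M)) × Fin d)
    (hιA : ∀ y κ r t, ιA (y, κ) (r, t) =
      ((fun i => (((y i).val * n + (r i : ℕ) : ℕ) : ZMod (n * M))) + Pi.single κ ((t : ℕ) : ZMod (n * M)), κ))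
    (ω : ℝ) (w' : (Fin d → ZMod M) × Fin d → (Fin d → Fin n) × Fin n → 𝔸ˣ) (hw' : ∀ j rt, w' j rt ∈ U1 𝔸)
    (R' : (Fin d → ZMod M) × Fin d → (Fin d → ZMod (n * M)) × Fin d → 𝔸 →ₗ[ℝ] 𝔸)
    (hR' : ∀ j c, R' j c = ω • ∑ rt ∈ Finset.univ.filter (fun rt => ιA j rt = c),
        LinearMap.mk ⟨conjR (w' j rt), conjR_add (w' j rt)⟩ (conjR_smul_real (w' j rt)))
    (Y : (Fin d → ZMod M) × Fin d → ((Fin d → ZMod (n * M)) → Fin d → 𝔸) → ℝ)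
    (hY : ∀ j B, Y j B = ‖ω • ∑ rt, conjR (w' j rt) (B (ιA j rt).1 (ιA j rt).2)‖)
    -- the displayed input: admissibility and the local floors of the localised fields
    (good : ((Fin d → ZMod (n * M)) × Fin d → 𝔸) → Prop) {cloc : ℝ}
    (hloc : ∀ (S : Fin d → ZMod Mp) (x : (Fin d → ZMod (n * M)) × Fin d → 𝔸), good x →
      cloc * ∑ c, ‖(∏ ν, Real.sin (Real.pi / 2 * tentZ (L : ℝ) (c.1 ν - (((S ν).val * L + c₀ : ℕ) : ZMod (n * M))))) • x c‖ ^ 2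
        ≤ ∑ P, ‖∑ c ∈ Finset.univ.image (ι P),
              R P c ((∏ ν, Real.sin (Real.pi / 2 * tentZ (L : ℝ) (c.1 ν - (((S ν).val * L + c₀ : ℕ) : ZMod (n * M))))) • x c)‖ ^ 2
          + ∑ j, ‖∑ c ∈ Finset.univ.image (ιA j),
              R' j c ((∏ ν, Real.sin (Real.pi / 2 * tentZ (L : ℝ) (c.1 ν - (((S ν).val * L + c₀ : ℕ) : ZMod (n * M))))) • x c)‖ ^ 2)
    {t : ℝ} (ht : 0 < t) (x : (Fin d → ZMod (n * M)) × Fin d → 𝔸) (hx : good x) :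
    (cloc - (1 + t⁻¹) * ((((2 ^ Fintype.card (Fin d) : ℕ)) : ℝ) * (1 : ℝ) ^ 2 * (Real.pi / (2 * L)) ^ 2 * (4 : ℕ) * (2 * (d - 1) : ℕ)
        + (((n ^ (d + 1) + 1) * 2 ^ Fintype.card (Fin d) : ℕ) : ℝ) * (|ω| * n) ^ 2
            * (((d + 1) * (n - 1) : ℕ) * (Real.pi / (2 * L))) ^ 2 * (n ^ (d + 1) : ℕ) * (n : ℕ))) / (1 + t)
        * ∑ c, ‖x c‖ ^ 2
      ≤ ∑ P, X P (fun y μ => x (y, μ)) ^ 2 + ∑ j, Y j (fun y μ => x (y, μ)) ^ 2 := by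
  classical
  have hF : ∀ z : (Fin d → ZMod (n * M)) × Fin d → 𝔸, good z →
      ∑ P, ‖∑ c ∈ Finset.univ.image (ι P), R P c (z c)‖ ^ 2 + ∑ j, ‖∑ c ∈ Finset.univ.image (ιA j), R' j c (z c)‖ ^ 2
        ≤ ∑ P, X P (fun y μ => z (y, μ)) ^ 2 + ∑ j, Y j (fun y μ => z (y, μ)) ^ 2 :=
    fun z _ => le_of_eq (by
      rw [sum_sq_norm_curlMaps_eq ι hι w R hR X hX (fun y μ => z (y, μ)),
        sum_sq_norm_avgMaps_eq n ιA ω w' R' hR' Y hY (fun y μ => z (y, μ))])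
  exact ims_floor_of_sine_tent_partition_two_unit_disp (A := Fin d) L Mp (n * M) hL hMp hN c₀
    (fun P => Finset.univ.image (ι P)) R (ℓ₁ := 1) (fun P c v => norm_curlMap_le ι w hw R hR P c v)
    (fun j => Finset.univ.image (ιA j)) R' (ℓ₂ := |ω| * n) (fun j c v => norm_avgMap_le n (NeZero.pos n) ιA hιA ω w' hw' R' hR' j c v)
    Prod.fst (fun P => ι P 0) (fun j => ιA j 0) (exists_unit_plaquetteBonds ι hι)
    ((d + 1) * (n - 1)) (exists_displacement_avgBonds n ιA hιA)
    (a₁ := 4) (b₁ := 2 * (d - 1)) (a₂ := n ^ (d + 1)) (b₂ := n)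
    (fun P => card_image_four_le (ι P)) (fun c => card_plaquettes_through_bond_le ι hι c)
    (fun j => card_image_avgBonds_le n ιA j) (fun c => card_terms_through_bond_le n ιA hιA (NeZero.pos n) c)
    good hloc (fun z => ∑ P, X P (fun y μ => z (y, μ)) ^ 2 + ∑ j, Y j (fun y μ => z (y, μ)) ^ 2) hF ht x hx

end Summit.QuantumFields.BalabanUV.T4Continuum.NE7b.FullFormSineFloor

end
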